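import Mathlib
import Summits.Ventures.PercRepro2.Defs
import Summits.Ventures.PercRepro2.CoinDefs
import Summits.Ventures.PercRepro2.CoinLsmCoreDefs
import Summits.Ventures.PercRepro2.CoinLsmCoreU
import Summits.Ventures.PercRepro2.CoinCoreGate
import Summits.Ventures.PercRepro2.CoinOrTailKDefs
import Summits.Ventures.PercRepro2.CoinOrTailKSums
import Summits.Ventures.PercRepro2.CoinOrTailKCore
import Summits.Ventures.PercRepro2.CoinOrTailLsmCore
import Summits.Ventures.PercRepro2.CoinK2HeadBlindVals
import Summits.Ventures.PercRepro2.CoinK2HeadAwareAD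
import Summits.Ventures.PercRepro2.CoinTreeCore
import Summits.Ventures.PercRepro2.CoinKSureGate
import Summits.Ventures.PercRepro2.CoinKSureCore
import Summits.Ventures.PercRepro2.CoinKSureTailSums

/-!
# Row 2′DARC at an OR-tail with a MARKER AT THE TAIL — the theorems (blind cell PercRepro2,
night-2 g15; proofs/NIGHT2-DARC.md §51; the sums and the functional are in CoinKSureTailSums)

Every theorem of the OR-tail theory (§35–§50) places the two markers `a, b` of row 2′DARC in
the core `U`.  Here one marker (or both) is the OR-vertex `a` itself — the tail of the free
arc: `X = 1[a ∈ S⁺]`.  With SURE entry coins `a ∈ S⁺` iff the core level meets the entry set,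
so `X` is the INCREASING function `W ↦ 1[W ∩ ent ≠ ∅]` of the core level, and the abstract
theorem `gate_functional_nonneg` (§49.5) takes arbitrary increasing markers:

* `orTailKSure_functional_nonneg_markers` — `orTailKSure_functional_nonneg` for ARBITRARY
  nonnegative increasing marker functions `x, y` on the core lattice;
* `OrTailK.sum_R_eq_tail` / `sum_G_eq_tail` — the core sums over `U ∪ {a}` with a marker that
  vanishes off `a` reduce to sums over `U` of the TAIL values `rValKa = (1 − tailWtK)·A(W ∪ {a})`
  and `gValKa = (1 − tailWtK)·A(W ∪ {a, w})` (every coin probability);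
* with sure coins `rValKa = rValK · 1[W ∩ ent ≠ ∅]` and `gValKa = gValK · 1[W ∩ ent ≠ ∅]`
  (`rValKa_sure`, `gValKa_sure`), so the functional is the product form of §49 with the marker
  `1[W ∩ ent ≠ ∅]`;
* `darc_of_orTailKSure_tail` (markers `a, m`), `darc_of_orTailKSure_tail'` (markers `m, a`,
  by the marker symmetry `darc_swap`), `darc_of_orTailKSure_tail₂` (both markers at `a`) and
  the out-tree corollaries `darc_of_orTailTreeKSure_tail*`.
-/

namespace Summit.Ventures.PercRepro2.Coin

open Classical

section TailMain

variable {V : Type*} {E : Type*} [Fintype V] [DecidableEq V] [Fintype E] [DecidableEq E]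
  {R : Type*} [Field R] [LinearOrder R] [IsStrictOrderedRing R]
  {arcs : E → Finset (V × V)} {s : V} {U : Finset V} {ent : Finset V} {c : V → E} {a w : V}

/-- **THEOREM (row 2′DARC at an OR-tail with sure entries, ONE MARKER AT THE TAIL).**
`OrTailK arcs s U ent c a` with any set of sure entries, `SameEnds`, the cluster law of `U`
log-supermodular, the markers `a` (the OR-vertex itself) and `m ∈ U`, every head:
`Φ_D({s ↛ t in D + (a → w)}) ≥ 0` for the markers `(a, m)`. -/
theorem darc_of_orTailKSure_tail (pr : E → R) (hp : IsProbVec pr) (hS : SameEnds arcs)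
    (h : OrTailK arcs s U ent c a) {m : V} (hm : m ∈ U)
    (hsure : ∀ r ∈ ent, pr (c r) = 1)
    (hν : ∀ W W', W ⊆ U → W' ⊆ U →
      prob pr (coreLevel arcs s U W) * prob pr (coreLevel arcs s U W') ≤
        prob pr (coreLevel arcs s U (W ∩ W')) * prob pr (coreLevel arcs s U (W ∪ W')))
    {t : V} (htC : t ∉ insert a U) (hts : t ≠ s) (hws : w ≠ s) (hwC : w ∉ insert a U) :
    DARC pr arcs s {t} a m a w := by
  have hC := h.closedInCoreU
  have hma : m ≠ a := fun e => h.a_notin (e ▸ hm)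
  have hmC : m ∈ insert a U := Finset.mem_insert_of_mem hm
  have haC : a ∈ insert a U := Finset.mem_insert_self _ _
  unfold DARC
  rw [hC.phiC_gate_eq pr hS htC hts haC hmC haC hws hwC]
  set A : Finset V → R := fun X => prob pr (coreAvoidEvent arcs s t (insert a U) X) with hAdef
  set ν : Finset V → R := fun W => prob pr (coreLevel arcs s U W) with hνdef
  -- the marker functions
  have hm1 : ∀ W : Finset V, (fun _ : Finset V => (1 : R)) (insert a W) = (fun _ => (1 : R)) W :=
    fun _ => rfl
  have hmq : ∀ W : Finset V, (fun W : Finset V => if m ∈ W then (1 : R) else 0) (insert a W) =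
      (fun W : Finset V => if m ∈ W then (1 : R) else 0) W := by
    intro W; simp only [Finset.mem_insert, hma, false_or]
  have hga0 : ∀ W : Finset V, a ∉ W → (fun W : Finset V => if a ∈ W then (1 : R) else 0) W = 0 := by
    intro W haW; simp only [haW, if_false]
  have hga1 : ∀ W : Finset V, a ∉ W →
      (fun W : Finset V => if a ∈ W then (1 : R) else 0) (insert a W) = (fun _ => (1 : R)) W := by
    intro W _; simp only [Finset.mem_insert_self, if_true]
  have hgq0 : ∀ W : Finset V, a ∉ W →
      (fun W : Finset V => (if a ∈ W then (1 : R) else 0) * (if m ∈ W then (1 : R) else 0)) W = 0 := by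
    intro W haW; simp only [haW, if_false, zero_mul]
  have hgq1 : ∀ W : Finset V, a ∉ W →
      (fun W : Finset V => (if a ∈ W then (1 : R) else 0) * (if m ∈ W then (1 : R) else 0))
          (insert a W) =
        (fun W : Finset V => if m ∈ W then (1 : R) else 0) W := by
    intro W _; simp only [Finset.mem_insert_self, if_true, one_mul, Finset.mem_insert, hma, false_or]
  have eΛ := h.sum_R_eq pr t (fun _ => (1 : R)) hm1
  have eΛa := h.sum_R_eq_tail pr t (fun W => if a ∈ W then (1 : R) else 0) (fun _ => (1 : R))
    hga0 hga1
  have eΛq := h.sum_R_eq pr t (fun W => if m ∈ W then (1 : R) else 0) hmq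
  have eM := h.sum_G_eq (w := w) pr t (fun _ => (1 : R)) hm1
  have eMa := h.sum_G_eq_tail (w := w) pr t (fun W => if a ∈ W then (1 : R) else 0)
    (fun _ => (1 : R)) hga0 hga1
  have eMq := h.sum_G_eq (w := w) pr t (fun W => if m ∈ W then (1 : R) else 0) hmq
  have eMaq := h.sum_G_eq_tail (w := w) pr t
    (fun W => (if a ∈ W then (1 : R) else 0) * (if m ∈ W then (1 : R) else 0))
    (fun W => if m ∈ W then (1 : R) else 0) hgq0 hgq1
  simp only [mul_one] at eΛ eΛa eM eMa
  rw [eΛ, eΛa, eΛq, eM, eMa, eMq, eMaq]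
  -- sure coins: the entered values are the values times the entry indicator
  have hra : ∀ W, rValKa A pr ent c a W = rValK A pr ent c a W * entInd ent W :=
    fun W => rValKa_sure A pr c a hsure W
  have hga : ∀ W, gValKa A pr ent c a w W = gValK A pr ent c a w W * entInd ent W :=
    fun W => gValKa_sure A pr c a w hsure W
  have e1 : ∑ W ∈ U.powerset, ν W * rValKa A pr ent c a W =
      ∑ W ∈ U.powerset, ν W * rValK A pr ent c a W * entInd ent W := by
    refine Finset.sum_congr rfl fun W _ => ?_
    rw [hra W]; ring
  have e2 : ∑ W ∈ U.powerset, ν W * gValKa A pr ent c a w W =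
      ∑ W ∈ U.powerset, ν W * gValK A pr ent c a w W * entInd ent W := by
    refine Finset.sum_congr rfl fun W _ => ?_
    rw [hga W]; ring
  have e3 : ∑ W ∈ U.powerset, ν W * gValKa A pr ent c a w W * (if m ∈ W then (1 : R) else 0) =
      ∑ W ∈ U.powerset, ν W * gValK A pr ent c a w W *
        (entInd ent W * (if m ∈ W then (1 : R) else 0)) := by
    refine Finset.sum_congr rfl fun W _ => ?_
    rw [hga W]; ring
  rw [e1, e2, e3]
  obtain ⟨hA0, hAmono, hAlsm⟩ := OrTailU.head_props (U := U) (a := a) pr hp hS t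
  have hy0 : ∀ W : Finset V, (0 : R) ≤ (if m ∈ W then (1 : R) else 0) := by
    intro W; split_ifs <;> norm_num
  have hym : ∀ s t : Finset V,
      (if m ∈ s then (1 : R) else 0) ≤ (if m ∈ s ∪ t then (1 : R) else 0) := by
    intro s t
    by_cases hms : m ∈ s
    · rw [if_pos hms, if_pos (Finset.mem_union_left t hms)]
    · rw [if_neg hms]; split_ifs <;> norm_num
  exact orTailKSure_functional_nonneg_markers U ν A pr ent c a w (fun W => entInd ent W)
    (fun W => if m ∈ W then (1 : R) else 0) hp.nonneg hp.le_one hsure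
    (fun W => prob_nonneg hp _) (fun s' hs' t' ht' => hν s' t' hs' ht') hA0 hAlsm hAmono
    (fun W => entInd_nonneg ent W) hy0 (fun s t => entInd_mono ent s t) hym

/-- **The mirror: markers `(m, a)`.** -/
theorem darc_of_orTailKSure_tail' (pr : E → R) (hp : IsProbVec pr) (hS : SameEnds arcs)
    (h : OrTailK arcs s U ent c a) {m : V} (hm : m ∈ U)
    (hsure : ∀ r ∈ ent, pr (c r) = 1)
    (hν : ∀ W W', W ⊆ U → W' ⊆ U →
      prob pr (coreLevel arcs s U W) * prob pr (coreLevel arcs s U W') ≤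
        prob pr (coreLevel arcs s U (W ∩ W')) * prob pr (coreLevel arcs s U (W ∪ W')))
    {t : V} (htC : t ∉ insert a U) (hts : t ≠ s) (hws : w ≠ s) (hwC : w ∉ insert a U) :
    DARC pr arcs s {t} m a a w :=
  (darc_swap pr arcs s {t} a m a w).1 (darc_of_orTailKSure_tail pr hp hS h hm hsure hν htC hts hws hwC)

/-- **THEOREM (BOTH markers at the tail).** `X = Y = 1[a ∈ S⁺]`: row 2′DARC at `a → w` for
the markers `(a, a)` — the gate VARIANCE form. -/
theorem darc_of_orTailKSure_tail₂ (pr : E → R) (hp : IsProbVec pr) (hS : SameEnds arcs)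
    (h : OrTailK arcs s U ent c a)
    (hsure : ∀ r ∈ ent, pr (c r) = 1)
    (hν : ∀ W W', W ⊆ U → W' ⊆ U →
      prob pr (coreLevel arcs s U W) * prob pr (coreLevel arcs s U W') ≤
        prob pr (coreLevel arcs s U (W ∩ W')) * prob pr (coreLevel arcs s U (W ∪ W')))
    {t : V} (htC : t ∉ insert a U) (hts : t ≠ s) (hws : w ≠ s) (hwC : w ∉ insert a U) :
    DARC pr arcs s {t} a a a w := by
  have hC := h.closedInCoreU
  have haC : a ∈ insert a U := Finset.mem_insert_self _ _
  unfold DARC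
  rw [hC.phiC_gate_eq pr hS htC hts haC haC haC hws hwC]
  set A : Finset V → R := fun X => prob pr (coreAvoidEvent arcs s t (insert a U) X) with hAdef
  set ν : Finset V → R := fun W => prob pr (coreLevel arcs s U W) with hνdef
  have hm1 : ∀ W : Finset V, (fun _ : Finset V => (1 : R)) (insert a W) = (fun _ => (1 : R)) W :=
    fun _ => rfl
  have hga0 : ∀ W : Finset V, a ∉ W → (fun W : Finset V => if a ∈ W then (1 : R) else 0) W = 0 := by
    intro W haW; simp only [haW, if_false]
  have hga1 : ∀ W : Finset V, a ∉ W →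
      (fun W : Finset V => if a ∈ W then (1 : R) else 0) (insert a W) = (fun _ => (1 : R)) W := by
    intro W _; simp only [Finset.mem_insert_self, if_true]
  have hgaa0 : ∀ W : Finset V, a ∉ W →
      (fun W : Finset V => (if a ∈ W then (1 : R) else 0) * (if a ∈ W then (1 : R) else 0)) W = 0 := by
    intro W haW; simp only [haW, if_false, zero_mul]
  have hgaa1 : ∀ W : Finset V, a ∉ W →
      (fun W : Finset V => (if a ∈ W then (1 : R) else 0) * (if a ∈ W then (1 : R) else 0))
          (insert a W) = (fun _ => (1 : R)) W := by
    intro W _; simp only [Finset.mem_insert_self, if_true, one_mul]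
  have eΛ := h.sum_R_eq pr t (fun _ => (1 : R)) hm1
  have eΛa := h.sum_R_eq_tail pr t (fun W => if a ∈ W then (1 : R) else 0) (fun _ => (1 : R))
    hga0 hga1
  have eM := h.sum_G_eq (w := w) pr t (fun _ => (1 : R)) hm1
  have eMa := h.sum_G_eq_tail (w := w) pr t (fun W => if a ∈ W then (1 : R) else 0)
    (fun _ => (1 : R)) hga0 hga1
  have eMaa := h.sum_G_eq_tail (w := w) pr t
    (fun W => (if a ∈ W then (1 : R) else 0) * (if a ∈ W then (1 : R) else 0))
    (fun _ => (1 : R)) hgaa0 hgaa1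
  simp only [mul_one] at eΛ eΛa eM eMa eMaa
  rw [eΛ, eΛa, eM, eMa, eMaa]
  have hra : ∀ W, rValKa A pr ent c a W = rValK A pr ent c a W * entInd ent W :=
    fun W => rValKa_sure A pr c a hsure W
  have hga : ∀ W, gValKa A pr ent c a w W = gValK A pr ent c a w W * entInd ent W :=
    fun W => gValKa_sure A pr c a w hsure W
  have e1 : ∑ W ∈ U.powerset, ν W * rValKa A pr ent c a W =
      ∑ W ∈ U.powerset, ν W * rValK A pr ent c a W * entInd ent W := by
    refine Finset.sum_congr rfl fun W _ => ?_
    rw [hra W]; ring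
  have e2 : ∑ W ∈ U.powerset, ν W * gValKa A pr ent c a w W =
      ∑ W ∈ U.powerset, ν W * gValK A pr ent c a w W * entInd ent W := by
    refine Finset.sum_congr rfl fun W _ => ?_
    rw [hga W]; ring
  have e3 : ∑ W ∈ U.powerset, ν W * gValKa A pr ent c a w W =
      ∑ W ∈ U.powerset, ν W * gValK A pr ent c a w W * (entInd ent W * entInd ent W) := by
    refine Finset.sum_congr rfl fun W _ => ?_
    rw [hga W, entInd_mul_self]; ring
  have key := orTailKSure_functional_nonneg_markers U ν A pr ent c a w (fun W => entInd ent W)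
    (fun W => entInd ent W) hp.nonneg hp.le_one hsure
    (fun W => prob_nonneg hp _) (fun s' hs' t' ht' => hν s' t' hs' ht')
    (OrTailU.head_props (U := U) (a := a) pr hp hS t).1
    (OrTailU.head_props (U := U) (a := a) pr hp hS t).2.2
    (OrTailU.head_props (U := U) (a := a) pr hp hS t).2.1
    (fun W => entInd_nonneg ent W) (fun W => entInd_nonneg ent W)
    (fun s t => entInd_mono ent s t) (fun s t => entInd_mono ent s t)
  rw [← e3, ← e2, ← e1] at key
  exact key

/-- **COROLLARY (out-tree core): one marker at the tail.** -/
theorem darc_of_orTailTreeKSure_tail (pr : E → R) (hp : IsProbVec pr) (hS : SameEnds arcs)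
    (h : OrTailK arcs s U ent c a) {c' : V → E} {par : V → V} {rk : V → ℕ}
    (hT : TreeCore arcs s U c' par rk) {m : V} (hm : m ∈ U)
    (hsure : ∀ r ∈ ent, pr (c r) = 1)
    {t : V} (htC : t ∉ insert a U) (hts : t ≠ s) (hws : w ≠ s) (hwC : w ∉ insert a U) :
    DARC pr arcs s {t} a m a w :=
  darc_of_orTailKSure_tail pr hp hS h hm hsure (hT.coreLevel_lsm pr hp) htC hts hws hwC

/-- **COROLLARY (out-tree core): both markers at the tail.** -/
theorem darc_of_orTailTreeKSure_tail₂ (pr : E → R) (hp : IsProbVec pr) (hS : SameEnds arcs)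
    (h : OrTailK arcs s U ent c a) {c' : V → E} {par : V → V} {rk : V → ℕ}
    (hT : TreeCore arcs s U c' par rk)
    (hsure : ∀ r ∈ ent, pr (c r) = 1)
    {t : V} (htC : t ∉ insert a U) (hts : t ≠ s) (hws : w ≠ s) (hwC : w ∉ insert a U) :
    DARC pr arcs s {t} a a a w :=
  darc_of_orTailKSure_tail₂ pr hp hS h hsure (hT.coreLevel_lsm pr hp) htC hts hws hwC

end TailMain

end Summit.Ventures.PercRepro2.Coin
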